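import Summits.CriticalPhenomena.PercolationContinuityZ3.Theorems.SahiMasterFamilyReadersDisjoint

/-!
# (TT_k) at EVERY order from the local-to-global step LG_k: `LocalToGlobal n → TerminalTight (n+1)`

Unit `prim-master-conj` (crux anchor stmt-CriticalPhenomena-4575), gen 12; memo HOME/prim-master-conj/TIGHTNESS-IV.md §3.
Gen 11 closed order four as `FrameFieldDisjoint` + THEOREM LG4 ⟹ `TerminalTight 1` ⟹ `MasterFamilyIdentEqIff 4`.  With frame-field
disjointness now a theorem at every order (`gframe_disjoint_all`, file `SahiMasterFamilyReadersDisjoint`), the assembly runs at every order and the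
ONLY order-specific input left is the local-to-global step, typed here as a named `Prop`:

* `LocalToGlobal n` — LG_{n+4} (the statement of `lg4_of_noAbsorber` with `4` replaced by `n + 4`): no family of `n + 4` non-empty non-sure
  increasing events on all of its index type has structured contraction faces, support-disjoint glued frames, a core-free coordinate with all
  deletion faces at core-free coordinates structured, `≥ 2` coordinates, no member containing the others, and NO structured deletion;
* `localToGlobal_zero` — LG_4 is gen 11's THEOREM LG4;
* **`terminalTight_of_localToGlobal : LocalToGlobal n → TerminalTight (n + 1)`**;
* **`masterFamilyIdentEqIff_all_of_localToGlobal : (∀ n, LocalToGlobal n) → ∀ k, MasterFamilyIdentEqIff k`**;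
* **`masterFamilyIdentEqIff_five_of_localToGlobal_one : LocalToGlobal 1 → MasterFamilyIdentEqIff 5`** (order four being a theorem).
HONEST FRAMING: `LocalToGlobal n` for `n ≥ 1` is OPEN (census-exact at `n = 1` on `{0,1}^4`); it is a hypothesis here, never a fact.
Pure combinatorics + the tree reductions; axioms standard. [this work]
-/

noncomputable section

open scoped Classical

namespace Summit.CriticalPhenomena.PercolationContinuityZ3.Theorems

namespace GluedFrames

open Finset Function
open Literature.Probability.LatticeModels.Kahn2022 (Affects)
open Literature.Probability.Percolation (DeterminedBy)

/-- **LG_{n+4}, the local-to-global step at order `n + 4`** (OPEN for `n ≥ 1`; `n = 0` is THEOREM LG4): there is no family of `n + 4` non-empty,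
non-sure increasing events, indexed by all of `Fin (n+4)`, such that every contraction face is structured, the glued frames have pairwise disjoint
essential supports, some coordinate is core-free and every deletion face at a core-free coordinate is structured, every coordinate has a companion,
no member contains all the others, and NO deletion `univ ∖ x` is structured. [this work] [status: open for n ≥ 1; census-exact n = 1 on {0,1}^4] -/
def LocalToGlobal (n : ℕ) : Prop :=
  ∀ (ι : Type) [Fintype ι] (U : Fin (n + 4) → Set (Set ι)), (∀ k, IsUpperSet (U k)) → (∀ k, (U k).Nonempty) →
    (∀ k, U k ≠ Set.univ) → (∀ h, Structured (faceT U h) univ) →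
    (∀ x x', x ≠ x' → Disjoint (esupp (gframe U univ x)) (esupp (gframe U univ x'))) →
    (∀ f, CoreFree U f → Structured (faceF U f) univ) → (∃ f, CoreFree U f) → (∀ f : ι, ∃ h, h ≠ f) →
    (∀ l, ∃ m, m ≠ l ∧ ¬ U m ⊆ U l) → (∀ x, ¬ Structured U (univ.erase x)) → False

/-- **LG_4 holds**: gen 11's THEOREM LG4 (`lg4_of_noAbsorber`). [this work] -/
theorem localToGlobal_zero : LocalToGlobal 0 := by
  intro ι _ U hU hne hns hS hd hF hE0 hι habs hdel
  exact lg4_of_noAbsorber U univ hU hne hns (fun k => mem_univ k) (by simp) hS (fun x _ x' _ hxx' => hd x x' hxx') hF hE0 hι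
    (fun l _ => by obtain ⟨m, hm, h⟩ := habs l; exact ⟨m, mem_univ m, hm, h⟩) (fun x _ hs => hdel x (by convert hs using 2))

/-- **(TT_{n+4}) on the full coordinate set, from LG_{n+4}** (frame-field disjointness being a theorem at every order). [this work] -/
theorem terminalTightAt_univ_of_localToGlobal (n : ℕ) (hLG : LocalToGlobal n) (ι : Type) [Fintype ι]
    (U : Fin (n + 1 + 3) → Set (Set ι)) : TerminalTightAt (n + 1) ι U univ := by
  intro hU _ hne h0 hno hc hpriv hall habs
  by_contra hcap
  -- a core-free coordinate exists (else the cap is `{univ}`, principal)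
  have hE0 : ∃ f, CoreFree U f := by
    by_contra hnone
    push Not at hnone
    refine hcap ⟨univ, fun T => ⟨fun hT => ?_, fun hT j => ?_⟩⟩
    · rw [coe_univ, Set.univ_subset_iff]
      by_contra hTu
      obtain ⟨f, hf⟩ := (Set.ne_univ_iff_exists_notMem T).1 hTu
      obtain ⟨k, hk⟩ : ∃ k, Set.univ \ {f} ∉ U k := by
        have := hnone f; unfold CoreFree at this; push Not at this; exact this
      exact hk (hU k (fun x hx => ⟨Set.mem_univ x, fun hxf => hf (hxf ▸ hx)⟩ : T ⊆ Set.univ \ {f}) (hT k))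
    · rw [coe_univ, Set.univ_subset_iff] at hT; subst hT; exact univ_mem_of_nonempty (hU j) (hne j)
  have hns : ∀ k, U k ≠ Set.univ := fun k hk => h0 k (hk ▸ Set.mem_univ _)
  -- at least two coordinates (else all members coincide with the unique non-trivial up-set and absorb each other)
  have hι : ∀ f : ι, ∃ h, h ≠ f := by
    intro f
    by_contra hsub
    push Not at hsub
    have hmem : ∀ j (ω : Set ι), ω ∈ U j ↔ f ∈ ω := by
      intro j ω
      constructor
      · intro hω; by_contra hfω
        have : ω = ∅ := Set.eq_empty_of_forall_notMem fun x hx => hfω ((hsub x) ▸ hx)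
        exact h0 j (this ▸ hω)
      · intro hfω
        have : ω = Set.univ := Set.eq_univ_of_forall fun x => (hsub x).symm ▸ hfω
        rw [this]; exact univ_mem_of_nonempty (hU j) (hne j)
    obtain ⟨l, -, hnot⟩ := habs 0
    exact hnot fun ω hω => (hmem 0 ω).2 ((hmem l ω).1 hω)
  -- faces structured
  have hS : ∀ h, Structured (faceT U h) univ := by
    intro h
    have hz : SuppZeroFlag ((n + 2) + 2) (fun j => faceT U h (id j)) := by exact hall h (mem_univ _) true
    have := structured_of_suppZeroFlag (n + 2) (faceT U h) (isUpperSet_faceT U hU h) (faceT_nonempty U hU hne h) id injective_id hz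
    convert this using 2; simp
  have hF : ∀ f, CoreFree U f → Structured (faceF U f) univ := by
    intro f hf
    have hz : SuppZeroFlag ((n + 2) + 2) (fun j => faceF U f (id j)) := by exact hall f (mem_univ _) false
    have := structured_of_suppZeroFlag (n + 2) (faceF U f) (isUpperSet_faceF U hU f) (faceF_nonempty U hf) id injective_id hz
    convert this using 2; simp
  have hd := gframe_disjoint_all n ι U hU hne h0 (fun e b => by exact hall e (mem_univ e) b) habs
  refine hLG ι U hU hne hns hS hd hF hE0 hι habs ?_
  intro x hs
  apply hno x
  refine suppZeroFlag_of_structured (n + 1) U hU hne (fun j => x.succAbove j) Fin.succAbove_right_injective ?_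
  convert hs using 2
  ext j
  simp [Fin.exists_succAbove_eq_iff]

/-- **`LocalToGlobal n → TerminalTight (n + 1)`.** [this work] -/
theorem terminalTight_of_localToGlobal (n : ℕ) (hLG : LocalToGlobal n) : TerminalTight (n + 1) :=
  terminalTight_of_univ (n + 1) fun ι _ U => terminalTightAt_univ_of_localToGlobal n hLG ι U

/-- **The identically-zero master conjecture at every order from the local-to-global steps**:
`(∀ n, LocalToGlobal n) → ∀ k, MasterFamilyIdentEqIff k`. [this work] -/
theorem masterFamilyIdentEqIff_all_of_localToGlobal (hLG : ∀ n, LocalToGlobal n) : ∀ k, MasterFamilyIdentEqIff k :=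
  masterFamilyIdentEqIff_all_of_terminalTight fun n => terminalTight_of_localToGlobal n (hLG n)

/-- **Order five from LG_5 alone** (order four is the tree theorem `masterFamilyIdentEqIff_four`):
`LocalToGlobal 1 → MasterFamilyIdentEqIff 5`. [this work] -/
theorem masterFamilyIdentEqIff_five_of_localToGlobal_one (hLG : LocalToGlobal 1) : MasterFamilyIdentEqIff 5 :=
  masterFamilyIdentEqIff_succ_of_terminalTight 1 masterFamilyIdentEqIff_four (terminalTight_of_localToGlobal 1 hLG)

end GluedFrames

end Summit.CriticalPhenomena.PercolationContinuityZ3.Theorems
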